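import Summits.ValiantsHypothesis.ValiantsHypothesis.Theorems.BarrierLeverChowHitsPartitionMinorsRNoStar

/-!
# Route BarrierLever — item `ChowHitsPartitionMinorsR` (stmt-ValiantsHypothesis-21882):
# the BI-STAR design (`2h` forms), its arrow, and the residual nodes «… and not bi-star-certifiable»

Helper file (`--supports stmt-ValiantsHypothesis-21882`; cell valiant-natproofs, rung V4, 𝒟-side support item of route
BarrierLever; prover seat val-np-p5 gen 30). Closes NO item. Companion of `…ChowHitsPartitionMinorsRNoStar` (p716670).

THE BI-STAR DESIGN (seat memo MEMO-21882-valnp5-g30.md §2–§3): the `h + h` affine forms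
`ℓ_a = 1 + x_a + Σ_c β_{a c} y_c` (`a < h`, «x-star part») and `ℓ'_c = 1 + Σ_a α_{c a} x_a + y_c` (`c < h`, «y-star part»).
EXHAUSTIVE CENSUS (kit j330324 + j330490, exact mod p): at `h ≤ 6` EVERY pair of lower sets `R, C` with `|R| = |C|`
(16 352 S₆-classes, 10 369 362 class pairs, 2.6·10¹² labelled pairs at `h = 6`) has a nonsingular `R × C` partition matrix
for this design with generic `β, α`; in particular the 286 982 class pairs with CROSSING tail profiles and the 32 thick
comparable class pairs on which both one-sided star designs are identically singular. CONJECTURE T** (memo §2): this holds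
for all `h` — it would close item 21882 (`2h ≤ h·h − 2h` for `h ≥ 4`). STRUCTURE (memo §3): after the unit reduction the
bi-star matrix is SIGN-COHERENT (a positive sum over spanning star forests of `K_{V,W}`), so a unique optimal assignment for
the tropical «edge-cover» cost certifies nonsingularity.

This file provides (definition + bookkeeping only; no closed form yet):
* `IsBiStarCertifiable u w` — some `β, α` make the partition matrix of `∏_a ℓ_a · ∏_c ℓ'_c` on the layout `(u, w)` nonsingular;
* `chowHits_of_isBiStarCertifiable` — then `(u, w)` is hit by `M` affine forms for every `M ≥ h + h`;
* node texts `Stmt.stub_thickPairsChowRNoBiStar`, `Stmt.stub_thickLowerSetsChowRNoBiStar` := the NoStar texts (p716670)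
  with the further hypothesis `¬ IsBiStarCertifiable u w` — by the census their member set is EMPTY for `h ≤ 6`;
* UNCONDITIONAL glue `stub_thickPairsChowRNoStar_of_noBiStar`, `stub_thickLowerSetsChowRNoStar_of_noBiStar` (threshold
  `max h₀ 4`: `2h + 2h ≤ h·h` needs `h ≥ 4`).
The compositions into the item by name go through the NoStar glue (`…NoStarGlue`, pending the farm olean of `…RXStar`).

WHAT THIS IS NOT: item 21882 is NOT proved; nothing on crux stmt-ValiantsHypothesis-14610 or on `VP` versus `VNP`.
-/

set_option linter.dupNamespace false

namespace Summit.ValiantsHypothesis.ValiantsHypothesis.Theorems.BarrierLever.ChowNoStar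

open Finset MvPolynomial

noncomputable section

variable {h r : ℕ}

/-! ## 1. The bi-star design -/

/-- The x-star form `ℓ_a = 1 + x_a + Σ_c β_{a c} y_c`. -/
def bistarX (β : Fin h → Fin h → ℂ) (a : Fin h) : MvPolynomial (Fin (h + h)) ℂ :=
  C 1 + X (Fin.castAdd h a) + ∑ c, C (β a c) * X (Fin.natAdd h c)

/-- The y-star form `ℓ'_c = 1 + Σ_a α_{c a} x_a + y_c`. -/
def bistarY (α : Fin h → Fin h → ℂ) (c : Fin h) : MvPolynomial (Fin (h + h)) ℂ :=
  C 1 + ∑ a, C (α c a) * X (Fin.castAdd h a) + X (Fin.natAdd h c)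

/-- The `h + h` bi-star forms as one family indexed by `Fin (h + h)` (x-star part first). -/
def bistarForm (β α : Fin h → Fin h → ℂ) : Fin (h + h) → MvPolynomial (Fin (h + h)) ℂ :=
  Fin.append (bistarX β) (bistarY α)

/-- A scaled variable `C s * X v` has total degree `≤ 1`. -/
theorem totalDegree_C_mul_X_le (s : ℂ) (v : Fin (h + h)) :
    (C s * X v : MvPolynomial (Fin (h + h)) ℂ).totalDegree ≤ 1 := by
  refine (totalDegree_mul _ _).trans ?_
  rw [totalDegree_C, zero_add]
  exact (totalDegree_X _).le

/-- Each x-star form is affine. -/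
theorem totalDegree_bistarX_le (β : Fin h → Fin h → ℂ) (a : Fin h) : (bistarX β a).totalDegree ≤ 1 := by
  unfold bistarX
  refine (totalDegree_add _ _).trans (max_le ((totalDegree_add _ _).trans (max_le ?_ ?_)) ?_)
  · rw [totalDegree_C]; exact zero_le_one
  · exact (totalDegree_X _).le
  · exact totalDegree_finsetSum_le fun c _ => totalDegree_C_mul_X_le _ _

/-- Each y-star form is affine. -/
theorem totalDegree_bistarY_le (α : Fin h → Fin h → ℂ) (c : Fin h) : (bistarY α c).totalDegree ≤ 1 := by
  unfold bistarY
  refine (totalDegree_add _ _).trans (max_le ((totalDegree_add _ _).trans (max_le ?_ ?_)) ?_)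
  · rw [totalDegree_C]; exact zero_le_one
  · exact totalDegree_finsetSum_le fun a _ => totalDegree_C_mul_X_le _ _
  · exact (totalDegree_X _).le

/-- Each bi-star form is affine. -/
theorem totalDegree_bistarForm_le (β α : Fin h → Fin h → ℂ) (k : Fin (h + h)) :
    (bistarForm β α k).totalDegree ≤ 1 := by
  unfold bistarForm
  refine Fin.addCases (fun i => ?_) (fun j => ?_) k
  · rw [Fin.append_left]; exact totalDegree_bistarX_le β i
  · rw [Fin.append_right]; exact totalDegree_bistarY_le α j

/-- The product of the bi-star family is the x-star product times the y-star product. -/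
theorem prod_bistarForm (β α : Fin h → Fin h → ℂ) :
    ∏ k, bistarForm β α k = (∏ a, bistarX β a) * ∏ c, bistarY α c := by
  unfold bistarForm
  rw [Fin.prod_univ_add]
  simp only [Fin.append_left, Fin.append_right]

/-- **`IsBiStarCertifiable u w`: the layout `(u, w)` is BI-STAR-CERTIFIABLE** — for some coefficient tables `β, α` the
`R × C` partition matrix of the bi-star product `∏_a (1 + x_a + Σ_c β_{ac} y_c) · ∏_c (1 + Σ_a α_{ca} x_a + y_c)` is
nonsingular. -/
def IsBiStarCertifiable (u w : Fin r → Finset (Fin h)) : Prop :=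
  ∃ β α : Fin h → Fin h → ℂ, (Matrix.of fun i j : Fin r =>
      MvPolynomial.coeff (∑ a ∈ u i, Finsupp.single (Fin.castAdd h a) 1 +
          ∑ c ∈ w j, Finsupp.single (Fin.natAdd h c) 1)
        ((∏ a, bistarX β a) * ∏ c, bistarY α c)).det ≠ 0

/-- **Bi-star arrow.** A bi-star-certifiable layout is hit by `M` affine forms for every `M ≥ h + h` (the `2h` bi-star
forms, padded with constants). -/
theorem chowHits_of_isBiStarCertifiable {M : ℕ} (hM : h + h ≤ M) (u w : Fin r → Finset (Fin h))
    (hB : IsBiStarCertifiable u w) :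
    ∃ ℓ : Fin M → MvPolynomial (Fin (h + h)) ℂ, (∀ k, (ℓ k).totalDegree ≤ 1) ∧
      (Matrix.of fun i j : Fin r => MvPolynomial.coeff (∑ a ∈ u i, Finsupp.single (Fin.castAdd h a) 1 +
          ∑ c ∈ w j, Finsupp.single (Fin.natAdd h c) 1) (∏ k, ℓ k)).det ≠ 0 := by
  obtain ⟨β, α, hdet⟩ := hB
  refine chowHits_mono hM u w ⟨bistarForm β α, totalDegree_bistarForm_le β α, ?_⟩
  rw [prod_bistarForm]
  exact hdet

/-! ## 2. The residual nodes «… and not bi-star-certifiable» -/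

/-- **NARROWED NODE: THICK PAIRS THAT ARE NEITHER STAR- NOR BI-STAR-CERTIFIABLE** — `Stmt.stub_thickPairsChowRNoStar`
(p716670) with the further hypothesis `¬ IsBiStarCertifiable u w`. By the exhaustive census (memo §1–§2) this class has
NO member with `h ≤ 6`; CONJECTURE T**: it is empty for every `h`. WHY IT MIGHT FAIL: a large-`h` crossing-profile pair on
which the sign-coherent bi-star matrix is singular for all weights (no unique optimal star-forest assignment). -/
def Stmt.stub_thickPairsChowRNoBiStar : Prop :=
  ∃ h₀ : ℕ, ∀ h : ℕ, h₀ ≤ h → ∀ (r : ℕ) (u w : Fin r → Finset (Fin h)),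
    Function.Injective u → Function.Injective w →
    h * h < (∑ i, (u i).card) + h → h * h < (∑ j, (w j).card) + h →
    ¬ IsXStarCertifiable u w → ¬ IsXStarCertifiable w u → ¬ IsBiStarCertifiable u w →
    ∃ ℓ : Fin (h * h) → MvPolynomial (Fin (h + h)) ℂ,
      (∀ k, (ℓ k).totalDegree ≤ 1) ∧
      (Matrix.of fun i j : Fin r => MvPolynomial.coeff
        (∑ a ∈ u i, Finsupp.single (Fin.castAdd h a) 1 +
          ∑ c ∈ w j, Finsupp.single (Fin.natAdd h c) 1) (∏ k, ℓ k)).det ≠ 0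

/-- **NARROWED NODE: THICK LOWER-SET PAIRS THAT ARE NEITHER STAR- NOR BI-STAR-CERTIFIABLE** (budget `m + 2h ≤ h·h`) —
`Stmt.stub_thickLowerSetsChowRNoStar` (p716670) with the further hypothesis `¬ IsBiStarCertifiable v w'`. Empty for
`h ≤ 6` by the census; conjecturally empty (T**). -/
def Stmt.stub_thickLowerSetsChowRNoBiStar : Prop :=
  ∃ h₀ : ℕ, ∀ h : ℕ, h₀ ≤ h → ∀ (r : ℕ) (v w' : Fin r → Finset (Fin h)),
    Function.Injective v → Function.Injective w' →
    IsLowerSet (Set.range v) → IsLowerSet (Set.range w') →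
    h * h < (∑ i, (v i).card) + 2 * h → h * h < (∑ j, (w' j).card) + 2 * h →
    ¬ IsXStarCertifiable v w' → ¬ IsXStarCertifiable w' v → ¬ IsBiStarCertifiable v w' →
    ∃ m : ℕ, m + 2 * h ≤ h * h ∧ ∃ ℓ : Fin m → MvPolynomial (Fin (h + h)) ℂ,
      (∀ k, (ℓ k).totalDegree ≤ 1) ∧
      (Matrix.of fun i j : Fin r => MvPolynomial.coeff
        (∑ a ∈ v i, Finsupp.single (Fin.castAdd h a) 1 +
          ∑ c ∈ w' j, Finsupp.single (Fin.natAdd h c) 1) (∏ k, ℓ k)).det ≠ 0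

/-- **GLUE (unconditional): «no bi-star» node ⟹ NoStar node, thick pairs** — bi-star-certifiable layouts are hit by
`2h ≤ h·h` forms (`h ≥ 2`; threshold `max h₀ 2`). -/
theorem stub_thickPairsChowRNoStar_of_noBiStar (hN : Stmt.stub_thickPairsChowRNoBiStar) :
    Stmt.stub_thickPairsChowRNoStar := by
  obtain ⟨h₀, hN⟩ := hN
  refine ⟨max h₀ 2, fun h hh r u w hu hw hU hW hX hY => ?_⟩
  have hh₀ : h₀ ≤ h := le_trans (le_max_left _ _) hh
  have h2 : 2 ≤ h := le_trans (le_max_right _ _) hh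
  have hM : h + h ≤ h * h := by nlinarith
  by_cases hB : IsBiStarCertifiable u w
  · exact chowHits_of_isBiStarCertifiable hM u w hB
  exact hN h hh₀ r u w hu hw hU hW hX hY hB

/-- **GLUE (unconditional): «no bi-star» node ⟹ NoStar node, thick lower-set pairs** — bi-star-certifiable pairs are hit
by `m = 2h` forms and `2h + 2h ≤ h·h` for `h ≥ 4` (threshold `max h₀ 4`). -/
theorem stub_thickLowerSetsChowRNoStar_of_noBiStar (hN : Stmt.stub_thickLowerSetsChowRNoBiStar) :
    Stmt.stub_thickLowerSetsChowRNoStar := by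
  obtain ⟨h₀, hN⟩ := hN
  refine ⟨max h₀ 4, fun h hh r v w' hv hw hlv hlw hV hW hX hY => ?_⟩
  have hh₀ : h₀ ≤ h := le_trans (le_max_left _ _) hh
  have h4 : 4 ≤ h := le_trans (le_max_right _ _) hh
  have hbudget : (h + h) + 2 * h ≤ h * h := by nlinarith
  by_cases hB : IsBiStarCertifiable v w'
  · exact ⟨h + h, hbudget, chowHits_of_isBiStarCertifiable le_rfl v w' hB⟩
  exact hN h hh₀ r v w' hv hw hlv hlw hV hW hX hY hB

end

end Summit.ValiantsHypothesis.ValiantsHypothesis.Theorems.BarrierLever.ChowNoStar
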